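import Mathlib

/-!
# SoloBlind — conjugate contraction ⇒ resolvent at `z = 1` with a metric bound (kernel #181)

E1-lite / LEMMA C glue (paper §24.105): a kernel-box certificate delivers a Lyapunov metric
`Y = R⋆R` in which the `r₁`-deleted period map `M` CONTRACTS, i.e. `‖R M R⁻¹‖ ≤ θ < 1`
(the norm of the conjugate is the operator norm of `M` in the `Y`-norm `‖v‖_Y = ‖R v‖`).
This file turns such a certificate into the three facts the assembly uses:

* `isUnit_one_sub_of_conj` : `1 - M` is invertible (the periodic solution operator of the deleted
  loop — the period-map form of the Volterra resolvent `(1 + 𝒦)⁻¹` — exists);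
* `conj_inverse_one_sub` : `R (1 - M)⁻¹ R⁻¹ = (1 - R M R⁻¹)⁻¹`;
* `norm_mul_inverse_one_sub_le` / `metricResolvent_bound` : the metric resolvent bound
  `‖R ((1 - M)⁻¹ v)‖ ≤ (1 - θ)⁻¹ ‖R v‖` (operator version; the normed-ring version carries the
  usual `‖1‖ - 1` correction of `tsum_geometric_le_of_norm_lt_one`).

Pure normed-ring algebra around `Units.oneSub` and the geometric series; no analysis of the flow.
-/

namespace Summit.AnomalousDissipation.AnomalousDissipation.Theorems

section Ring

variable {A : Type*} [NormedRing A]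

/-- Conjugation commutes with `1 - ·`: `r (1 - m) r⁻¹ = 1 - r m r⁻¹`. -/
theorem conj_one_sub (r : Aˣ) (m : A) :
    (r : A) * (1 - m) * (↑r⁻¹ : A) = 1 - (r : A) * m * (↑r⁻¹ : A) := by
  rw [mul_sub, sub_mul, mul_one, Units.mul_inv]

/-- `1 - m = r⁻¹ (1 - r m r⁻¹) r`. -/
theorem one_sub_eq_conj (r : Aˣ) (m : A) :
    (1 - m) = (↑r⁻¹ : A) * (1 - (r : A) * m * (↑r⁻¹ : A)) * r := by
  rw [← conj_one_sub]
  simp only [mul_assoc, Units.inv_mul_cancel_left, Units.inv_mul, mul_one]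

/-- The unit structure on `1 - m` obtained by conjugating `Units.oneSub (r m r⁻¹)` back. -/
noncomputable def oneSubOfConj [HasSummableGeomSeries A] (r : Aˣ) (m : A) (h : ‖(r : A) * m * (↑r⁻¹ : A)‖ < 1) : Aˣ :=
  r⁻¹ * Units.oneSub ((r : A) * m * (↑r⁻¹ : A)) h * r

/-- The conjugated unit has value `1 - m`. -/
theorem val_oneSubOfConj [HasSummableGeomSeries A] (r : Aˣ) (m : A) (h : ‖(r : A) * m * (↑r⁻¹ : A)‖ < 1) :
    (oneSubOfConj r m h : A) = 1 - m := by
  rw [oneSubOfConj, Units.val_mul, Units.val_mul, Units.val_oneSub, ← one_sub_eq_conj]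

/-- CONTRACTION IN A CONJUGATE NORM ⇒ INVERTIBILITY of `1 - m`. -/
theorem isUnit_one_sub_of_conj [HasSummableGeomSeries A] (r : Aˣ) (m : A) (h : ‖(r : A) * m * (↑r⁻¹ : A)‖ < 1) :
    IsUnit (1 - m) :=
  ⟨oneSubOfConj r m h, val_oneSubOfConj r m h⟩

/-- The conjugated resolvent is the resolvent of the conjugate. -/
theorem conj_inverse_one_sub [HasSummableGeomSeries A] (r : Aˣ) (m : A) (h : ‖(r : A) * m * (↑r⁻¹ : A)‖ < 1) :
    (r : A) * Ring.inverse (1 - m) * (↑r⁻¹ : A) =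
      Ring.inverse (1 - (r : A) * m * (↑r⁻¹ : A)) := by
  rw [← val_oneSubOfConj r m h, Ring.inverse_unit,
    ← Units.val_oneSub ((r : A) * m * (↑r⁻¹ : A)) h, Ring.inverse_unit, oneSubOfConj,
    mul_inv_rev, mul_inv_rev, inv_inv, Units.val_mul, Units.val_mul,
    Units.mul_inv_cancel_left, Units.mul_inv_cancel_right]

/-- Norm bound for the conjugated resolvent (geometric series; no `‖1‖ = 1` assumed). -/
theorem norm_conj_inverse_one_sub_le [HasSummableGeomSeries A] (r : Aˣ) (m : A) (h : ‖(r : A) * m * (↑r⁻¹ : A)‖ < 1) :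
    ‖(r : A) * Ring.inverse (1 - m) * (↑r⁻¹ : A)‖ ≤
      ‖(1 : A)‖ - 1 + (1 - ‖(r : A) * m * (↑r⁻¹ : A)‖)⁻¹ := by
  rw [conj_inverse_one_sub r m h, ← geom_series_eq_inverse _ h]
  exact tsum_geometric_le_of_norm_lt_one _ h

/-- METRIC RESOLVENT BOUND (normed-ring form): with `‖r m r⁻¹‖ ≤ θ < 1`,
`‖r ((1 - m)⁻¹ v)‖ ≤ (‖1‖ - 1 + (1 - θ)⁻¹) ‖r v‖`. -/
theorem norm_mul_inverse_one_sub_le [HasSummableGeomSeries A] (r : Aˣ) (m v : A) {θ : ℝ} (hθ : θ < 1)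
    (h : ‖(r : A) * m * (↑r⁻¹ : A)‖ ≤ θ) :
    ‖(r : A) * (Ring.inverse (1 - m) * v)‖ ≤
      (‖(1 : A)‖ - 1 + (1 - θ)⁻¹) * ‖(r : A) * v‖ := by
  have h1 : ‖(r : A) * m * (↑r⁻¹ : A)‖ < 1 := lt_of_le_of_lt h hθ
  have key : (r : A) * (Ring.inverse (1 - m) * v) =
      ((r : A) * Ring.inverse (1 - m) * (↑r⁻¹ : A)) * ((r : A) * v) := by
    simp only [mul_assoc, Units.inv_mul_cancel_left]
  rw [key]
  refine le_trans (norm_mul_le _ _) ?_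
  have hθ' : 0 < 1 - θ := by linarith
  have hi : (1 - ‖(r : A) * m * (↑r⁻¹ : A)‖)⁻¹ ≤ (1 - θ)⁻¹ := inv_anti₀ hθ' (by linarith)
  have hc : ‖(r : A) * Ring.inverse (1 - m) * (↑r⁻¹ : A)‖ ≤ ‖(1 : A)‖ - 1 + (1 - θ)⁻¹ := by
    have hb := norm_conj_inverse_one_sub_le r m h1
    linarith
  exact mul_le_mul_of_nonneg_right hc (norm_nonneg _)

end Ring

section Operator

variable {𝕜 E : Type*} [NontriviallyNormedField 𝕜] [NormedAddCommGroup E] [NormedSpace 𝕜 E]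
  [CompleteSpace E]

/-- METRIC RESOLVENT BOUND (operator form).  `R` an invertible bounded operator (the Cholesky
factor of the Lyapunov metric), `M` a bounded operator (the deleted period map) with
`‖R M R⁻¹‖ ≤ θ < 1`.  Then `1 - M` is invertible and, for every `v`,
`‖R ((1 - M)⁻¹ v)‖ ≤ (1 - θ)⁻¹ · ‖R v‖`. -/
theorem metricResolvent_bound (R : (E →L[𝕜] E)ˣ) (M : E →L[𝕜] E) {θ : ℝ} (hθ : θ < 1)
    (h : ‖(R : E →L[𝕜] E) * M * (↑R⁻¹ : E →L[𝕜] E)‖ ≤ θ) (v : E) :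
    IsUnit (1 - M) ∧
      ‖(R : E →L[𝕜] E) (Ring.inverse (1 - M) v)‖ ≤ (1 - θ)⁻¹ * ‖(R : E →L[𝕜] E) v‖ := by
  have h1 : ‖(R : E →L[𝕜] E) * M * (↑R⁻¹ : E →L[𝕜] E)‖ < 1 := lt_of_le_of_lt h hθ
  refine ⟨isUnit_one_sub_of_conj R M h1, ?_⟩
  have key : (R : E →L[𝕜] E) (Ring.inverse (1 - M) v) =
      ((R : E →L[𝕜] E) * Ring.inverse (1 - M) * (↑R⁻¹ : E →L[𝕜] E)) ((R : E →L[𝕜] E) v) := by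
    rw [mul_apply_eq_comp, mul_apply_eq_comp,
      ← mul_apply_eq_comp (↑R⁻¹ : E →L[𝕜] E) (R : E →L[𝕜] E) v, Units.inv_mul,
      one_apply_eq_self]
  rw [key]
  refine le_trans (ContinuousLinearMap.le_opNorm _ _) ?_
  have hθ' : 0 < 1 - θ := by linarith
  have h1le : ‖(1 : E →L[𝕜] E)‖ ≤ 1 := ContinuousLinearMap.norm_id_le
  have hc : ‖(R : E →L[𝕜] E) * Ring.inverse (1 - M) * (↑R⁻¹ : E →L[𝕜] E)‖ ≤ (1 - θ)⁻¹ := by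
    have hb := norm_conj_inverse_one_sub_le R M h1
    have hi : (1 - ‖(R : E →L[𝕜] E) * M * (↑R⁻¹ : E →L[𝕜] E)‖)⁻¹ ≤ (1 - θ)⁻¹ :=
      inv_anti₀ hθ' (by linarith)
    linarith
  exact mul_le_mul_of_nonneg_right hc (norm_nonneg _)

end Operator

end Summit.AnomalousDissipation.AnomalousDissipation.Theorems
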